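import Summits.CriticalPhenomena.PercolationContinuityZ3.Theorems.PercNearOneGluingNoHeavyQuantTreeClusterTransfer
import Mathlib.Algebra.Order.Ring.Pow
import HarnessLib

/-!
# QUANT lane R8: the two-arm level bound in gate coordinates (tool for the factor-`2` sharpness of FAR)

builds on p205010 (kernel theorem, internal audit signed; external expert review pending)

Support file (`--supports stmt-CriticalPhenomena-4575`), QUANT lane typer seat prim-quant-stmt (gen 9); consumed by
`…QuantFarFactorTwoSharp.lean` (`QuantCensus.farRelayRow_factor_two_sharp`: for every `c < 2`, `2j+1 ≤ |A| ∧ c·j < EN ∧ max cut ≤ t`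
does NOT imply `P(N ≤ j) ≤ t` — census-1 g6's two-arm tree family, CENSUS-GAIN §14.7, made symbolic through `Quant.tree_relayCount_transfer`,
p219638).  Theorems only; no definitions, no named facts, no sorries, no certificates; standard axioms.

The two-arm shape in GATE coordinates (`prodBernoulli q` on the subsets of `Fin n`, a vertex `a` counted when `a = o` or its whole ancestral
line `par^[i] a`, `i ≤ depth a`, lies in the random set — the right-hand side of `Quant.tree_relayCount_transfer`): a hub `h` (depth `0`, gate `g`)
with a set `L` of `k + 2` leaves (depth `1`, parent `h`, gate `u`), and a gateway `b ≠ h` (depth `0`, gate `g`) with a set `B` of at most `k` further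
relays (depth `1`, parent `b`); relays `A ⊆ L ∪ {b} ∪ B`, observer `o ∉ A`.

* `QuantCensus.twoArm_level_ge` — **`P_q(#{a ∈ A counted} ≤ k + 1) ≥ g(1 − g) + (1 − g)(1 − g·u^{k+2})`**: the event contains the disjoint
  gate-cylinders '`b` open, `h` shut' (only `b` and `B` can be counted: `≤ k + 1`) and '`b` shut and not all of `h`, `L` open' (only leaves are
  counted, and not all `k + 2` of them); their probabilities are `g(1−g)` and `(1−g) − (1−g)·g·u^{k+2}`
  (`prodBernoulli_real_inter_of_determinedBy_disjoint`, `prodBernoulli_real_setOf_mem/notMem`, `prodBernoulli_real_subset`).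
* `QuantCensus.card_filter_val_Icc` — `#{x : Fin n | a ≤ x < b+1} = b + 1 − a` for `b < n` (bookkeeping for the concrete family).
* `QuantCensus.upow_le` — Bernoulli's inequality in the form `((k+2)²/((k+2)²+1))^{k+2} ≤ (k+2)/(k+3)`.
[cite: KozmaNitzan2024, Conjecture 3 (p. 15)] (context: the FAR row whose threshold constant this serves to test)
-/

noncomputable section

namespace Summit.CriticalPhenomena.PercolationContinuityZ3.Theorems

namespace QuantCensus

open Finset MeasureTheory
open Literature.Probability.LatticeModels
open Literature.Probability.Percolation
open scoped Classical

/-- Counting the elements of `Fin n` in a value window: `#{x | a ≤ x.val ≤ b} = b + 1 − a` when `b < n`. [folklore] -/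
theorem card_filter_val_Icc (n a b : ℕ) (hb : b < n) :
    (univ.filter fun x : Fin n => a ≤ x.val ∧ x.val ≤ b).card = b + 1 - a := by
  have h1 : ((univ.filter fun x : Fin n => a ≤ x.val ∧ x.val ≤ b).map Fin.valEmbedding) =
      (Finset.Iio n).filter (fun v => a ≤ v ∧ v ≤ b) := by
    rw [← Fin.map_valEmbedding_univ, Finset.filter_map]
    rfl
  have h2 : (Finset.Iio n).filter (fun v => a ≤ v ∧ v ≤ b) = Finset.Icc a b := by
    ext v
    simp only [Finset.mem_filter, Finset.mem_Iio, Finset.mem_Icc]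
    omega
  rw [← Finset.card_map Fin.valEmbedding, h1, h2, Nat.card_Icc]

/-- **The two-arm level bound in gate coordinates.**  Vertices `Fin n` with independent gates `q`; a hub `h` (gate `g`) with leaves `L`
(`|L| = k + 2`, parent `h`, depth `1`, gates `u`), a gateway `b ≠ h` (gate `g`) with further relays `B` (`|B| ≤ k`, parent `b`, depth `1`);
relays `A ⊆ L ∪ {b} ∪ B` avoiding the observer `o`.  Counting `a ∈ A` when `a = o` or all of `par^[i] a`, `i ≤ depth a`, are open:
`P_q(count ≤ k + 1) ≥ g(1 − g) + (1 − g)(1 − g·u^{k+2})`. [this work] -/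
theorem twoArm_level_ge {n : ℕ} (q : Fin n → unitInterval) (o h b : Fin n) (L B A : Finset (Fin n))
    (depth : Fin n → ℕ) (par : Fin n → Fin n) (k : ℕ) (g u : ℝ)
    (hA : ∀ a ∈ A, a ≠ o ∧ (a ∈ L ∨ a = b ∨ a ∈ B))
    (hL : ∀ a ∈ L, par a = h ∧ depth a = 1) (hB : ∀ a ∈ B, par a = b ∧ depth a = 1)
    (hbh : b ≠ h) (hhL : h ∉ L) (hbL : b ∉ L) (hLcard : L.card = k + 2) (hBcard : B.card ≤ k)
    (hqh : ((q h : unitInterval) : ℝ) = g) (hqb : ((q b : unitInterval) : ℝ) = g) (hqL : ∀ a ∈ L, ((q a : unitInterval) : ℝ) = u) :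
    g * (1 - g) + (1 - g) * (1 - g * u ^ (k + 2)) ≤
      (prodBernoulli q).real {ω' : Set (Fin n) |
        (A.filter fun a => a = o ∨ ∀ i, i ≤ depth a → par^[i] a ∈ ω').card ≤ k + 1} := by
  set μ := prodBernoulli q with hμ
  -- the two events
  set E2 : Set (Set (Fin n)) := {ω' | b ∈ ω'} ∩ {ω' | h ∉ ω'} with hE2
  set C : Set (Set (Fin n)) := {ω' | b ∉ ω'} with hC
  set D : Set (Set (Fin n)) := {ω' | ((insert h L : Finset _) : Set (Fin n)) ⊆ ω'} with hD
  set E1 : Set (Set (Fin n)) := C \ (C ∩ D) with hE1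
  -- what a counted relay looks like
  have hmem : ∀ (ω' : Set (Fin n)) (a : Fin n), a ∈ (A.filter fun a => a = o ∨ ∀ i, i ≤ depth a → par^[i] a ∈ ω') →
      (a ∈ L ∧ a ∈ ω' ∧ h ∈ ω') ∨ (a = b ∧ b ∈ ω') ∨ (a ∈ B ∧ b ∈ ω') := by
    intro ω' a ha
    rw [Finset.mem_filter] at ha
    obtain ⟨haA, hc⟩ := ha
    obtain ⟨hao, hcase⟩ := hA a haA
    rcases hc with hc | hc
    · exact absurd hc hao
    · rcases hcase with haL | hab | haB
      · obtain ⟨hpa, hda⟩ := hL a haL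
        refine Or.inl ⟨haL, by simpa using hc 0 (Nat.zero_le _), ?_⟩
        have := hc 1 (by rw [hda])
        simpa [hpa] using this
      · refine Or.inr (Or.inl ⟨hab, ?_⟩)
        have := hc 0 (Nat.zero_le _)
        simpa [hab] using this
      · obtain ⟨hpa, hda⟩ := hB a haB
        refine Or.inr (Or.inr ⟨haB, ?_⟩)
        have := hc 1 (by rw [hda])
        simpa [hpa] using this
  -- inclusion
  have hsub : E1 ∪ E2 ⊆ {ω' : Set (Fin n) | (A.filter fun a => a = o ∨ ∀ i, i ≤ depth a → par^[i] a ∈ ω').card ≤ k + 1} := by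
    intro ω' hω'
    simp only [Set.mem_setOf_eq]
    rcases hω' with hω' | hω'
    · -- `b` shut and not all of `h`, `L` open: only leaves are counted, and not all of them
      obtain ⟨hC', hCD⟩ := hω'
      have hbω : b ∉ ω' := hC'
      have hD' : ¬ (((insert h L : Finset _) : Set (Fin n)) ⊆ ω') := fun h' => hCD ⟨hC', h'⟩
      rw [Set.not_subset] at hD'
      obtain ⟨x, hx, hxω⟩ := hD'
      rw [Finset.mem_coe, Finset.mem_insert] at hx
      have hleaf : ∀ a, a ∈ (A.filter fun a => a = o ∨ ∀ i, i ≤ depth a → par^[i] a ∈ ω') → a ∈ L ∧ a ∈ ω' ∧ h ∈ ω' := by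
        intro a ha
        rcases hmem ω' a ha with h1 | ⟨-, h2⟩ | ⟨-, h3⟩
        · exact h1
        · exact absurd h2 hbω
        · exact absurd h3 hbω
      rcases hx with hx | hx
      · rw [hx] at hxω
        have : (A.filter fun a => a = o ∨ ∀ i, i ≤ depth a → par^[i] a ∈ ω') = ∅ := by
          rw [Finset.eq_empty_iff_forall_notMem]
          intro a ha
          exact hxω (hleaf a ha).2.2
        rw [this, Finset.card_empty]; omega
      · have hincl : (A.filter fun a => a = o ∨ ∀ i, i ≤ depth a → par^[i] a ∈ ω') ⊆ L.erase x := by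
          intro a ha
          obtain ⟨haL, haω, -⟩ := hleaf a ha
          exact Finset.mem_erase.2 ⟨fun hax => hxω (hax ▸ haω), haL⟩
        have := Finset.card_le_card hincl
        rw [Finset.card_erase_of_mem hx, hLcard] at this
        omega
    · -- `b` open, `h` shut: only `b` and `B` are counted
      obtain ⟨-, hh⟩ := hω'
      have hh' : h ∉ ω' := hh
      have hincl : (A.filter fun a => a = o ∨ ∀ i, i ≤ depth a → par^[i] a ∈ ω') ⊆ insert b B := by
        intro a ha
        rw [Finset.mem_insert]
        rcases hmem ω' a ha with ⟨-, -, h1⟩ | ⟨h2, -⟩ | ⟨h3, -⟩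
        · exact absurd h1 hh'
        · exact Or.inl h2
        · exact Or.inr h3
      have := (Finset.card_le_card hincl).trans (Finset.card_insert_le _ _)
      omega
  -- probabilities
  have hdet_mem : ∀ x : Fin n, DeterminedBy {ω' : Set (Fin n) | x ∈ ω'} (↑({x} : Finset (Fin n))) := by
    intro x
    rw [determinedBy_iff]
    intro ω ω' hωω'
    have := Set.ext_iff.1 hωω' x
    simp only [Finset.coe_singleton, Set.mem_inter_iff, Set.mem_singleton_iff, and_true] at this
    exact this
  have hdet_notMem : ∀ x : Fin n, DeterminedBy {ω' : Set (Fin n) | x ∉ ω'} (↑({x} : Finset (Fin n))) := by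
    intro x
    rw [determinedBy_iff]
    intro ω ω' hωω'
    have := Set.ext_iff.1 hωω' x
    simp only [Finset.coe_singleton, Set.mem_inter_iff, Set.mem_singleton_iff, and_true] at this
    simp only [Set.mem_setOf_eq]
    exact not_congr this
  have hdet_D : DeterminedBy D (↑(insert h L : Finset (Fin n))) := by
    rw [determinedBy_iff]
    intro ω ω' hωω'
    simp only [hD, Set.mem_setOf_eq, Set.subset_def, Finset.mem_coe]
    refine forall_congr' fun y => imp_congr_right fun hy => ?_
    have := Set.ext_iff.1 hωω' y
    simp only [Set.mem_inter_iff, Finset.mem_coe, hy, and_true] at this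
    exact this
  have hE2' : μ.real E2 = g * (1 - g) := by
    rw [hE2, hμ, prodBernoulli_real_inter_of_determinedBy_disjoint q (Finset.disjoint_singleton.2 hbh)
      (hdet_mem b) (hdet_notMem h) MeasurableSet.of_discrete MeasurableSet.of_discrete,
      prodBernoulli_real_setOf_mem, prodBernoulli_real_setOf_notMem, hqb, hqh]
  have hC' : μ.real C = 1 - g := by
    rw [hC, hμ, prodBernoulli_real_setOf_notMem, hqb]
  have hCD : μ.real (C ∩ D) = (1 - g) * (g * u ^ (k + 2)) := by
    have hdisj : Disjoint ({b} : Finset (Fin n)) (insert h L) := by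
      rw [Finset.disjoint_singleton_left, Finset.mem_insert, not_or]
      exact ⟨hbh, hbL⟩
    rw [hμ, prodBernoulli_real_inter_of_determinedBy_disjoint q hdisj (hdet_notMem b) hdet_D
      MeasurableSet.of_discrete MeasurableSet.of_discrete, prodBernoulli_real_setOf_notMem, hqb]
    rw [hD, prodBernoulli_real_subset, Finset.prod_insert hhL, Finset.prod_congr rfl hqL, Finset.prod_const, hLcard, hqh]
  have hE1' : μ.real E1 = (1 - g) * (1 - g * u ^ (k + 2)) := by
    rw [hE1, measureReal_sdiff Set.inter_subset_left MeasurableSet.of_discrete, hC', hCD]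
    ring
  have hdisjE : Disjoint E1 E2 := by
    rw [Set.disjoint_left]
    rintro ω' ⟨hC1, -⟩ ⟨hb2, -⟩
    exact hC1 hb2
  calc g * (1 - g) + (1 - g) * (1 - g * u ^ (k + 2))
      = μ.real (E1 ∪ E2) := by rw [measureReal_union hdisjE MeasurableSet.of_discrete, hE1', hE2']; ring
    _ ≤ μ.real {ω' : Set (Fin n) | (A.filter fun a => a = o ∨ ∀ i, i ≤ depth a → par^[i] a ∈ ω').card ≤ k + 1} :=
          measureReal_mono hsub (measure_ne_top _ _)

/-- Bernoulli's inequality for the leaf gate of the two-arm family: `((k+2)²/((k+2)²+1))^{k+2} ≤ (k+2)/(k+3)`. [folklore] -/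
theorem upow_le (k : ℕ) :
    (((k : ℝ) + 2) ^ 2 / (((k : ℝ) + 2) ^ 2 + 1)) ^ (k + 2) ≤ ((k : ℝ) + 2) / ((k : ℝ) + 3) := by
  set m : ℝ := (k : ℝ) + 2 with hm
  have hm0 : 0 < m := by rw [hm]; positivity
  have hmne : m ≠ 0 := hm0.ne'
  have hB : 1 + ((k + 2 : ℕ) : ℝ) * (1 / m ^ 2) ≤ (1 + 1 / m ^ 2) ^ (k + 2) :=
    one_add_mul_le_pow (by linarith [show (0 : ℝ) ≤ 1 / m ^ 2 by positivity]) (k + 2)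
  have hk2 : ((k + 2 : ℕ) : ℝ) = m := by rw [hm]; norm_num
  have h1 : 1 + m * (1 / m ^ 2) = (m + 1) / m := by field_simp
  rw [hk2, h1] at hB
  have hu : m ^ 2 / (m ^ 2 + 1) = (1 + 1 / m ^ 2)⁻¹ := by
    field_simp
  have h3 : (k : ℝ) + 3 = m + 1 := by rw [hm]; ring
  rw [hu, inv_pow, h3]
  have hpos : 0 < (m + 1) / m := by positivity
  calc ((1 + 1 / m ^ 2) ^ (k + 2))⁻¹ ≤ ((m + 1) / m)⁻¹ := inv_anti₀ hpos hB
    _ = m / (m + 1) := by rw [inv_div]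

end QuantCensus

end Summit.CriticalPhenomena.PercolationContinuityZ3.Theorems

end
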